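import Mathlib.Algebra.BigOperators.Fin
import Mathlib.Data.List.GetD
import Literature.Computability.Complexity.GaussRank
import HarnessLib

/-!
# Rank by Gaussian elimination, II: the same sweep on lists

Sequel of `GaussRank.lean` (the column sweep `GaussRank.runTo` on rows `Fin M → Fin N → F` with
`GaussRank.rank_eq_finrank_span`). A string machine holds the rows as a LIST of (flag, list of
entries); this file writes the identical sweep as a function on `List (Bool × List F)` built only
from the list operations a polynomial-time functional program has (`foldl`, `mapIdx`, `zipWith`,
`getD`) and proves that it computes the same pivot count, hence the dimension of the row span:

* `cand j br`, `findStep`, `lfind j rows` — the index of the first non-pivot row with a nonzero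
  entry in column `j`, as a left fold (`lfind_eq_findIdx`);
* `lelimRow j piv r = zipWith (c·x − r_j·y) r piv`, `lstep rows j` (`mapIdx`), `lrun`, `lrank N rows`
  (fold over `range N`, then count the flags);
* `toState` — reading a list state as a `GaussRank.State` (total, via `getD`);
  `toState_lstep` — one column of the list sweep is one column of the functional sweep;
  `toState_lrun`; `countP_eq_card_filter`;
* **`lrank_eq_rank`** and **`lrank_eq_finrank_span`**: for rows of a common length `N`,
  `lrank N rows = finrank F (span F (range (row vectors)))`.

All statements are proved; `F` is any field with decidable equality.

## References

* J. von zur Gathen, J. Gerhard, *Modern Computer Algebra*, 3rd ed., CUP 2013, §12.1 (Gaussian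
  elimination). (Schoolbook; proved here.)
-/

namespace Literature.Computability.Complexity

namespace GaussRank

open Finset Module

variable {F : Type*} [Field F] [DecidableEq F] {M N : ℕ}

/-! ### The list sweep -/

/-- Row `br` is a pivot candidate for column `j`: not yet a pivot, nonzero in column `j`.
[folklore] -/
def cand (j : ℕ) (br : Bool × List F) : Bool := !br.1 && decide (br.2.getD j 0 ≠ 0)

/-- The step of the search fold: `(found, index)`. [folklore] -/
def findStep (j : ℕ) (acc : Bool × ℕ) (br : Bool × List F) : Bool × ℕ :=
  if acc.1 then acc else if cand j br then (true, acc.2) else (false, acc.2 + 1)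

/-- **The index of the first pivot candidate for column `j`** (the length of the list if there is
none), computed by a left fold. [folklore] -/
def lfind (j : ℕ) (rows : List (Bool × List F)) : ℕ := (rows.foldl (findStep j) (false, 0)).2

/-- Fraction-free elimination of one row against the pivot row: `c·r − r_j·piv` entrywise, with
`c = piv_j`. [folklore] -/
def lelimRow (j : ℕ) (piv r : List F) : List F :=
  List.zipWith (fun x y => piv.getD j 0 * x - r.getD j 0 * y) r piv

/-- **One column of the list sweep**: find the pivot candidate; if any, flag it and eliminate the
column from every other row. [folklore] -/
def lstep (rows : List (Bool × List F)) (j : ℕ) : List (Bool × List F) :=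
  if lfind j rows < rows.length then
    rows.mapIdx fun i br =>
      if i = lfind j rows then (true, br.2)
      else (br.1, lelimRow j (rows.getD (lfind j rows) (false, [])).2 br.2)
  else rows

/-- The list sweep over the columns `0, …, t-1`. [folklore] -/
def lrun (t : ℕ) (rows : List (Bool × List F)) : List (Bool × List F) :=
  (List.range t).foldl lstep rows

/-- **The rank of a list of rows of length `N`**: sweep all `N` columns starting with no flags,
then count the flags. [folklore] -/
def lrank (N : ℕ) (rows : List (List F)) : ℕ :=
  (lrun N (rows.map fun r => (false, r))).countP fun br => br.1

/-! ### The search fold finds the first candidate -/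

omit [Field F] [DecidableEq F] in
/-- Once found, the search fold is stationary. [folklore] -/
theorem foldl_findStep_true [Field F] [DecidableEq F] (j k : ℕ) (rows : List (Bool × List F)) :
    rows.foldl (findStep j) (true, k) = (true, k) := by
  induction rows with
  | nil => rfl
  | cons br rows ih => rw [List.foldl_cons, show findStep j (true, k) br = (true, k) by simp [findStep], ih]

/-- The search fold computes `findIdx`, shifted by the start index. [folklore] -/
theorem foldl_findStep_false (j : ℕ) (rows : List (Bool × List F)) (k : ℕ) :
    (rows.foldl (findStep j) (false, k)).2 = k + rows.findIdx (cand j) := by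
  induction rows generalizing k with
  | nil => simp
  | cons br rows ih =>
    rw [List.foldl_cons, List.findIdx_cons]
    by_cases hc : cand j br = true
    · rw [show findStep j (false, k) br = (true, k) by simp [findStep, hc], foldl_findStep_true]
      simp [hc]
    · rw [show findStep j (false, k) br = (false, k + 1) by simp [findStep, hc], ih (k + 1)]
      simp [hc]
      omega

/-- **`lfind` is the index of the first candidate.** [folklore] -/
theorem lfind_eq_findIdx (j : ℕ) (rows : List (Bool × List F)) :
    lfind j rows = rows.findIdx (cand j) := by
  rw [lfind, foldl_findStep_false, Nat.zero_add]

/-! ### Shape -/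

omit [DecidableEq F] in
/-- `lelimRow` keeps the common length. [folklore] -/
theorem length_lelimRow (j : ℕ) {piv r : List F} (hp : piv.length = N) (hr : r.length = N) :
    (lelimRow j piv r).length = N := by
  rw [lelimRow, List.length_zipWith, hr, hp, min_self]

/-- `lstep` keeps the number of rows. [folklore] -/
theorem length_lstep (rows : List (Bool × List F)) (j : ℕ) : (lstep rows j).length = rows.length := by
  unfold lstep
  split_ifs
  · rw [List.length_mapIdx]
  · rfl

/-- `lstep` keeps the common row length. [folklore] -/
theorem length_of_mem_lstep {rows : List (Bool × List F)} (hN : ∀ br ∈ rows, br.2.length = N)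
    (j : ℕ) : ∀ br ∈ lstep rows j, br.2.length = N := by
  intro br hbr
  unfold lstep at hbr
  split_ifs at hbr with hlt
  · rw [List.mem_mapIdx] at hbr
    obtain ⟨i, hi, rfl⟩ := hbr
    split_ifs
    · show (rows[i]'hi).2.length = N
      exact hN _ (List.getElem_mem hi)
    · show (lelimRow j _ (rows[i]'hi).2).length = N
      refine length_lelimRow j (hN _ ?_) (hN _ (List.getElem_mem hi))
      rw [List.getD_eq_getElem _ _ hlt]
      exact List.getElem_mem hlt
  · exact hN br hbr

/-- `lrun` keeps the number of rows. [folklore] -/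
theorem length_lrun (t : ℕ) (rows : List (Bool × List F)) : (lrun t rows).length = rows.length := by
  induction t with
  | zero => rfl
  | succ t ih => rw [lrun, List.range_succ, List.foldl_append, List.foldl_cons, List.foldl_nil,
      length_lstep, ← lrun, ih]

/-- `lrun` keeps the common row length. [folklore] -/
theorem length_of_mem_lrun {rows : List (Bool × List F)} (hN : ∀ br ∈ rows, br.2.length = N) :
    ∀ t, ∀ br ∈ lrun t rows, br.2.length = N
  | 0 => hN
  | t + 1 => by
    rw [lrun, List.range_succ, List.foldl_append, List.foldl_cons, List.foldl_nil, ← lrun]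
    exact length_of_mem_lstep (length_of_mem_lrun hN t) t

/-! ### Reading a list state as a functional state -/

/-- The functional state read off a list state (total: out-of-range reads give `false`/`0`).
[folklore] -/
def toState (M N : ℕ) (rows : List (Bool × List F)) : State F M N where
  rows i k := (rows.getD i (false, [])).2.getD k 0
  piv i := (rows.getD i (false, [])).1

omit [DecidableEq F] in
/-- Reading the rows. [folklore] -/
theorem toState_rows (rows : List (Bool × List F)) (i : Fin M) (k : Fin N) :
    (toState M N rows).rows i k = (rows.getD i (false, [])).2.getD k 0 := rfl

omit [DecidableEq F] in
/-- Reading the flags. [folklore] -/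
theorem toState_piv (rows : List (Bool × List F)) (i : Fin M) :
    (toState M N rows).piv i = (rows.getD i (false, [])).1 := rfl

omit [Field F] [DecidableEq F] in
/-- Two states with the same rows and flags are equal. [folklore] -/
theorem State.ext' {s₁ s₂ : State F M N} (h : s₁.rows = s₂.rows) (h' : s₁.piv = s₂.piv) : s₁ = s₂ := by
  cases s₁; cases s₂; cases h; cases h'; rfl

omit [Field F] [DecidableEq F] in
/-- Reading an entry of `mapIdx` with a default. [folklore] -/
theorem getD_mapIdx {α β : Type*} (f : ℕ → α → β) (l : List α) {i : ℕ} (h : i < l.length) (d : β) :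
    (l.mapIdx f).getD i d = f i (l[i]) := by
  rw [List.getD_eq_getElem _ _ (by simpa using h), List.getElem_mapIdx]

/-- The candidate test read functionally. [folklore] -/
theorem cand_iff {rows : List (Bool × List F)} (hM : rows.length = M) (j : Fin N) (i : Fin M) :
    cand j (rows[(i : ℕ)]'(by omega)) = true ↔
      (toState M N rows).piv i = false ∧ (toState M N rows).rows i j ≠ 0 := by
  rw [toState_piv, toState_rows, List.getD_eq_getElem _ _ (show (i : ℕ) < rows.length by omega)]
  simp [cand]

/-- **The list search is the functional `pick`**: if the first candidate index is in range, `pick`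
returns it. [folklore] -/
theorem pick_toState_some {rows : List (Bool × List F)} (hM : rows.length = M) (j : Fin N)
    (hlt : rows.findIdx (cand j) < rows.length) :
    pick (toState M N rows) j = some ⟨rows.findIdx (cand j), by omega⟩ := by
  have hc0 : cand (j : ℕ) (rows[rows.findIdx (cand j)]'hlt) = true := List.findIdx_getElem (w := hlt)
  have hc0' := (cand_iff hM j ⟨rows.findIdx (cand j), by omega⟩).1 hc0
  cases hp : pick (toState M N rows) j with
  | none => exact absurd hp (pick_ne_none hc0'.1 hc0'.2)
  | some i₁ =>
    congr 1
    rcases lt_trichotomy i₁ ⟨rows.findIdx (cand j), by omega⟩ with hlt' | heq | hgt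
    · -- a candidate before the first candidate: impossible
      obtain ⟨h1, h2⟩ := pick_spec hp
      have hc1 : cand (j : ℕ) (rows[(i₁ : ℕ)]'(by omega)) = true := (cand_iff hM j i₁).2 ⟨h1, h2⟩
      have hlt'' : (i₁ : ℕ) < rows.findIdx (cand j) := hlt'
      have h3 := List.not_of_lt_findIdx hlt''
      exact absurd (hc1.symm.trans h3) (by simp)
    · exact heq
    · exact absurd hc0' (pick_min hp hgt)

/-- If there is no candidate in range, `pick` finds nothing. [folklore] -/
theorem pick_toState_none {rows : List (Bool × List F)} (hM : rows.length = M) (j : Fin N)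
    (hge : ¬rows.findIdx (cand j) < rows.length) :
    pick (toState M N rows) j = none := by
  by_contra hp
  obtain ⟨i₁, hi₁⟩ := Option.ne_none_iff_exists'.1 hp
  obtain ⟨h1, h2⟩ := pick_spec hi₁
  have hc1 : cand (j : ℕ) (rows[(i₁ : ℕ)]'(by omega)) = true := (cand_iff hM j i₁).2 ⟨h1, h2⟩
  have : rows.findIdx (cand j) < rows.length :=
    List.findIdx_lt_length_of_exists ⟨_, List.getElem_mem (by omega), hc1⟩
  exact hge this

/-- **One column of the list sweep is one column of the functional sweep.** [folklore] -/
theorem toState_lstep {rows : List (Bool × List F)} (hM : rows.length = M)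
    (hN : ∀ br ∈ rows, br.2.length = N) (j : Fin N) :
    toState M N (lstep rows j) = step (toState M N rows) j := by
  unfold lstep step
  simp only [lfind_eq_findIdx]
  by_cases hlt : rows.findIdx (cand (j : ℕ)) < rows.length
  · rw [if_pos hlt, pick_toState_some hM j hlt]
    dsimp only
    have hpiv : rows.getD (rows.findIdx (cand (j : ℕ))) (false, []) = rows[rows.findIdx (cand (j : ℕ))]'hlt :=
      List.getD_eq_getElem _ _ hlt
    have hlenp : (rows[rows.findIdx (cand (j : ℕ))]'hlt).2.length = N := hN _ (List.getElem_mem hlt)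
    refine State.ext' (funext fun i => funext fun k => ?_) (funext fun i => ?_)
    · -- rows
      have hi : (i : ℕ) < rows.length := by omega
      have hleni : (rows[(i : ℕ)]'hi).2.length = N := hN _ (List.getElem_mem hi)
      rw [toState_rows, getD_mapIdx _ _ hi]
      by_cases hii : (i : ℕ) = rows.findIdx (cand (j : ℕ))
      · rw [if_pos hii]
        dsimp only
        have hfi : i = ⟨rows.findIdx (cand (j : ℕ)), by omega⟩ := Fin.ext hii
        conv_rhs => rw [← hfi]
        rw [elim_rows_self, toState_rows, List.getD_eq_getElem _ _ hi]
      · rw [if_neg hii, elim_rows_ne _ _ (fun h => hii (congrArg Fin.val h))]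
        dsimp only
        have hk1 : (k : ℕ) < (rows[(i : ℕ)]'hi).2.length := by rw [hleni]; exact k.isLt
        have hk2 : (k : ℕ) < (rows[rows.findIdx (cand (j : ℕ))]'hlt).2.length := by
          rw [hlenp]; exact k.isLt
        have hj1 : (j : ℕ) < (rows[(i : ℕ)]'hi).2.length := by rw [hleni]; exact j.isLt
        have hj2 : (j : ℕ) < (rows[rows.findIdx (cand (j : ℕ))]'hlt).2.length := by
          rw [hlenp]; exact j.isLt
        have hkz : (k : ℕ) <
            (lelimRow (j : ℕ) (rows[rows.findIdx (cand (j : ℕ))]'hlt).2 (rows[(i : ℕ)]'hi).2).length := by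
          rw [length_lelimRow _ hlenp hleni]; exact k.isLt
        rw [hpiv, List.getD_eq_getElem _ _ hkz]
        simp only [lelimRow, List.getElem_zipWith, toState_rows, List.getD_eq_getElem _ _ hlt,
          List.getD_eq_getElem _ _ hi, List.getD_eq_getElem _ _ hk1, List.getD_eq_getElem _ _ hk2,
          List.getD_eq_getElem _ _ hj1, List.getD_eq_getElem _ _ hj2]
    · -- flags
      have hi : (i : ℕ) < rows.length := by omega
      rw [toState_piv, getD_mapIdx _ _ hi, elim_piv]
      by_cases hii : (i : ℕ) = rows.findIdx (cand (j : ℕ))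
      · rw [if_pos hii, if_pos (Fin.ext hii)]
      · rw [if_neg hii, if_neg (fun h => hii (congrArg Fin.val h)), toState_piv,
          List.getD_eq_getElem _ _ hi]
  · rw [if_neg hlt, pick_toState_none hM j hlt]

/-- The list sweep read functionally is the functional sweep (`t ≤ N` columns). [folklore] -/
theorem toState_lrun {rows : List (Bool × List F)} (hM : rows.length = M)
    (hN : ∀ br ∈ rows, br.2.length = N) (hpiv : ∀ br ∈ rows, br.1 = false) :
    ∀ t, t ≤ N → toState M N (lrun t rows) = runTo (toState M N rows).rows t
  | 0, _ => by
    rw [lrun, List.range_zero, List.foldl_nil, runTo, init]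
    refine State.ext' rfl (funext fun i => ?_)
    rw [toState_piv]
    by_cases hi : (i : ℕ) < rows.length
    · rw [List.getD_eq_getElem _ _ hi]; exact hpiv _ (List.getElem_mem hi)
    · rw [List.getD_eq_default _ _ (not_lt.1 hi)]
  | t + 1, ht => by
    have ih := toState_lrun hM hN hpiv t (Nat.le_of_succ_le ht)
    rw [lrun, List.range_succ, List.foldl_append, List.foldl_cons, List.foldl_nil, ← lrun, runTo,
      dif_pos (Nat.lt_of_succ_le ht)]
    rw [toState_lstep (by rw [length_lrun, hM]) (length_of_mem_lrun hN t) ⟨t, Nat.lt_of_succ_le ht⟩,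
      ih]

/-! ### Counting the flags -/

omit [Field F] [DecidableEq F] in
/-- Counting a predicate along a list is counting the indices where it holds (entries read with
a default). [folklore] -/
theorem countP_eq_card_filter {α : Type*} (p : α → Bool) (d : α) :
    ∀ (l : List α) (n : ℕ), l.length = n →
      l.countP p = (univ.filter fun i : Fin n => p (l.getD i d) = true).card
  | [], n, hl => by subst hl; simp
  | a :: l, n, hl => by
    obtain ⟨m, rfl⟩ : ∃ m, n = m + 1 := ⟨l.length, by simpa using hl.symm⟩
    have hl' : l.length = m := by simpa using hl
    rw [List.countP_cons, countP_eq_card_filter p d l m hl', Finset.card_filter, Finset.card_filter,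
      Fin.sum_univ_succ]
    simp only [Fin.val_zero, List.getD_cons_zero, Fin.val_succ, List.getD_cons_succ]
    rw [add_comm]

/-- **The list rank is the functional rank.** [folklore] -/
theorem lrank_eq_rank (rows : List (List F)) (hN : ∀ r ∈ rows, r.length = N) :
    lrank N rows = rank (M := rows.length) (N := N)
      fun (i : Fin rows.length) (k : Fin N) => (rows.getD i []).getD k 0 := by
  set rows₀ : List (Bool × List F) := rows.map fun r => (false, r) with hrows₀
  have hM : rows₀.length = rows.length := by rw [hrows₀, List.length_map]
  have hN₀ : ∀ br ∈ rows₀, br.2.length = N := by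
    intro br hbr
    rw [hrows₀, List.mem_map] at hbr
    obtain ⟨r, hr, rfl⟩ := hbr
    exact hN r hr
  have hpiv₀ : ∀ br ∈ rows₀, br.1 = false := by
    intro br hbr
    rw [hrows₀, List.mem_map] at hbr
    obtain ⟨r, -, rfl⟩ := hbr
    rfl
  have hA : (toState rows.length N rows₀).rows =
      fun (i : Fin rows.length) (k : Fin N) => (rows.getD i []).getD k 0 := by
    funext i k
    rw [toState_rows, hrows₀, show ((false, []) : Bool × List F) = (fun r : List F => (false, r)) []
      from rfl, List.getD_map]
  have hrun := toState_lrun hM hN₀ hpiv₀ N le_rfl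
  rw [hA] at hrun
  have hlen : (lrun N rows₀).length = rows.length := by rw [length_lrun, hM]
  rw [lrank, rank, ← hrun, ← hrows₀,
    countP_eq_card_filter _ (false, []) (lrun N rows₀) rows.length hlen]
  rfl

/-- **The list rank is the dimension of the row span**: for a list of rows of common length `N`,
`lrank N rows = finrank F (span F {row vectors})`. [folklore] -/
theorem lrank_eq_finrank_span (rows : List (List F)) (hN : ∀ r ∈ rows, r.length = N) :
    lrank N rows = Module.finrank F (Submodule.span F
      (Set.range fun i : Fin rows.length => fun k : Fin N => (rows.getD i []).getD k 0)) := by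
  rw [lrank_eq_rank rows hN, rank_eq_finrank_span]

end GaussRank

end Literature.Computability.Complexity
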